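import Summits.CriticalPhenomena.PercolationContinuityZ3.Theorems.PercNearOneGluingNoHeavyLowerTailSahiE3MajPatternRows
import Mathlib.Data.Fintype.Pi
import Mathlib.Data.Fin.VecNotation
import HarnessLib
import HarnessLib.Audit

/-!
# `NoHeavyLowerTail` (crux stmt-CriticalPhenomena-4575), Sahi programme P4 (Holley / monotone coupling):
# Sahi's `C₃` for every slot generated by three join-primes — the twenty up-sets of the pattern cube

Support file (cell `prim-l12`, seat P4, generation 10; `--supports stmt-CriticalPhenomena-4575`).  No named facts, no sorries; standard
axioms; def-free.

THEOREM (`latticeE3_nonneg_of_threePrimes`).  `L` a finite distributive lattice, `μ ≥ 0` log-supermodular, `A, B` up-sets, `j₁, j₂, j₃`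
join-prime, and `U'` ANY up-set of patterns `Fin 3 → Bool`; then `0 ≤ latticeE3 μ U A B` for the preimage slot
`U = {x | (j₁ ≤ x, j₂ ≤ x, j₃ ≤ x) ∈ U'}` — i.e. for every slot in the sublattice of up-sets generated by `↑j₁, ↑j₂, ↑j₃`
(all unions of the principal up-sets `↑(⊔_{i∈I} jᵢ)`).  PROOF: the twenty up-sets of `2³` (`upset_cases`) fall into the classes settled in
the tree: `∅` (the functional vanishes), principal slots [Sahi 2008, Thm 2; Blinovsky] (`Literature…latticeE3_nonneg_of_principal`: `{⊤}`,
`↑(xy)`, `↑x`, everything), two join-primes (`…SahiE3TwoPrimeSlot`, generation 6), `↑(f⊔j₁) ∪ ↑(f⊔j₂)` (`…SahiE3FilterRestriction`, gen 8),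
majority (`…SahiE3MajSlot`, gen 9), `↑j ∪ ↑(j'⊔j″)` (`…SahiE3OrPairSlot`, gen 10) and the hitting slot `↑j₁ ∪ ↑j₂ ∪ ↑j₃` (`…SahiE3Hit3Slot`,
gen 10).  On the programme's `k = 5` residual atlas this covers the 762 of 1,067 tri-saturated orbits having a slot that is a 3-junta.
-/

namespace Summit.CriticalPhenomena.PercolationContinuityZ3.Theorems.SahiE3ThreePrimes

open Finset Literature.Probability.LatticeModels
open scoped BigOperators

/-- The up-sets of the pattern cube `2³`: twenty explicit sets. [folklore] -/
theorem upset_cases (U' : Finset (Fin 3 → Bool)) (hU : IsUpperSet (U' : Set (Fin 3 → Bool))) :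
    U' = ∅ ∨ U' = ({![true, true, true]} : Finset (Fin 3 → Bool)) ∨ U' = ({![true, true, false], ![true, true,
        true]} : Finset (Fin 3 → Bool)) ∨ U' = ({![true, false, true], ![true, true,
        true]} : Finset (Fin 3 → Bool)) ∨ U' = ({![false, true, true], ![true, true,
        true]} : Finset (Fin 3 → Bool)) ∨ U' = ({![true, true, false], ![true, false, true], ![true, true,
        true]} : Finset (Fin 3 → Bool)) ∨ U' = ({![true, true, false], ![false, true, true], ![true, true,
        true]} : Finset (Fin 3 → Bool)) ∨ U' = ({![true, false, true], ![false, true, true], ![true, true,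
        true]} : Finset (Fin 3 → Bool)) ∨ U' = ({![true, false, false], ![true, true, false], ![true, false, true],
        ![true, true, true]} : Finset (Fin 3 → Bool)) ∨ U' = ({![false, true, false], ![true, true, false], ![false,
        true, true], ![true, true, true]} : Finset (Fin 3 → Bool)) ∨ U' = ({![false, false, true], ![true, false,
        true], ![false, true, true], ![true, true, true]} : Finset (Fin 3 → Bool)) ∨ U' = ({![true, true, false],
        ![true, false, true], ![false, true, true], ![true, true, true]} : Finset (Fin 3 → Bool)) ∨ U' = ({![true,
        false, false], ![true, true, false], ![true, false, true], ![false, true, true], ![true, true,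
        true]} : Finset (Fin 3 → Bool)) ∨ U' = ({![false, true, false], ![true, true, false], ![true, false, true],
        ![false, true, true], ![true, true, true]} : Finset (Fin 3 → Bool)) ∨ U' = ({![false, false, true], ![true,
        true, false], ![true, false, true], ![false, true, true], ![true, true,
        true]} : Finset (Fin 3 → Bool)) ∨ U' = ({![true, false, false], ![false, true, false], ![true, true, false],
        ![true, false, true], ![false, true, true], ![true, true, true]} : Finset (Fin 3 → Bool)) ∨ U' = ({![true,
        false, false], ![false, false, true], ![true, true, false], ![true, false, true], ![false, true, true],
        ![true, true, true]} : Finset (Fin 3 → Bool)) ∨ U' = ({![false, true, false], ![false, false, true], ![true,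
        true, false], ![true, false, true], ![false, true, true], ![true, true,
        true]} : Finset (Fin 3 → Bool)) ∨ U' = ({![true, false, false], ![false, true, false], ![false, false, true],
        ![true, true, false], ![true, false, true], ![false, true, true], ![true, true,
        true]} : Finset (Fin 3 → Bool)) ∨ U' = univ := by
  letI : DecidableLE (Fin 3 → Bool) := fun a b => inferInstanceAs (Decidable (∀ i, a i ≤ b i))
  have ordf : (∀ x : Fin 3 → Bool, ![false, false, false] ≤ x) ∧ ![true, false, false] ≤ ![true, true, false] ∧
      ![true, false, false] ≤ ![true, false, true] ∧ ![false, true, false] ≤ ![true, true, false] ∧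
      ![false, true, false] ≤ ![false, true, true] ∧ ![false, false, true] ≤ ![true, false, true] ∧
      ![false, false, true] ≤ ![false, true, true] ∧ ![true, false, false] ≤ ![true, true, true] ∧
      ![false, true, false] ≤ ![true, true, true] ∧ ![false, false, true] ≤ ![true, true, true] ∧
      ![true, true, false] ≤ ![true, true, true] ∧ ![true, false, true] ≤ ![true, true, true] ∧
      ![false, true, true] ≤ ![true, true, true] := by decide
  obtain ⟨hbot, l_0_01, l_0_02, l_1_01, l_1_12, l_2_02, l_2_12, l_0_T, l_1_T, l_2_T, l_01_T, l_02_T, l_12_T⟩ := ordf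
  have up : ∀ {x y : Fin 3 → Bool}, x ≤ y → x ∈ U' → y ∈ U' := fun hxy hx => hU hxy hx
  by_cases hb : ![false, false, false] ∈ U'
  · refine Or.inr (Or.inr (Or.inr (Or.inr (Or.inr (Or.inr (Or.inr (Or.inr (Or.inr (Or.inr (Or.inr (Or.inr (Or.inr
      (Or.inr (Or.inr (Or.inr (Or.inr (Or.inr (Or.inr (?_)))))))))))))))))))
    ext x
    simp only [Finset.mem_univ, iff_true]
    exact up (hbot x) hb
  by_cases cT : ![true, true, true] ∈ U'
  · -- T ∈ U'
    by_cases c01 : ![true, true, false] ∈ U'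
    · -- 01 ∈ U'
      by_cases c02 : ![true, false, true] ∈ U'
      · -- 02 ∈ U'
        by_cases c12 : ![false, true, true] ∈ U'
        · -- 12 ∈ U'
          by_cases c0 : ![true, false, false] ∈ U'
          · -- 0 ∈ U'
            by_cases c1 : ![false, true, false] ∈ U'
            · -- 1 ∈ U'
              by_cases c2 : ![false, false, true] ∈ U'
              · -- 2 ∈ U'
                refine Or.inr (Or.inr (Or.inr (Or.inr (Or.inr (Or.inr (Or.inr (Or.inr (Or.inr (Or.inr (Or.inr (Or.inr
                    (Or.inr (Or.inr (Or.inr (Or.inr (Or.inr (Or.inr (Or.inl ?_))))))))))))))))))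
                ext x
                rcases SahiE3MajPattern.pts x with rfl | rfl | rfl | rfl | rfl | rfl | rfl | rfl <;> simp [hb, cT,
                    c01, c02, c12, c0, c1, c2]
              · -- 2 ∉ U'
                refine Or.inr (Or.inr (Or.inr (Or.inr (Or.inr (Or.inr (Or.inr (Or.inr (Or.inr (Or.inr (Or.inr (Or.inr
                    (Or.inr (Or.inr (Or.inr (Or.inl ?_)))))))))))))))
                ext x
                rcases SahiE3MajPattern.pts x with rfl | rfl | rfl | rfl | rfl | rfl | rfl | rfl <;> simp [hb, cT,
                    c01, c02, c12, c0, c1, c2]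
            · -- 1 ∉ U'
              by_cases c2 : ![false, false, true] ∈ U'
              · -- 2 ∈ U'
                refine Or.inr (Or.inr (Or.inr (Or.inr (Or.inr (Or.inr (Or.inr (Or.inr (Or.inr (Or.inr (Or.inr (Or.inr
                    (Or.inr (Or.inr (Or.inr (Or.inr (Or.inl ?_))))))))))))))))
                ext x
                rcases SahiE3MajPattern.pts x with rfl | rfl | rfl | rfl | rfl | rfl | rfl | rfl <;> simp [hb, cT,
                    c01, c02, c12, c0, c1, c2]
              · -- 2 ∉ U'
                refine Or.inr (Or.inr (Or.inr (Or.inr (Or.inr (Or.inr (Or.inr (Or.inr (Or.inr (Or.inr (Or.inr (Or.inr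
                    (Or.inl ?_))))))))))))
                ext x
                rcases SahiE3MajPattern.pts x with rfl | rfl | rfl | rfl | rfl | rfl | rfl | rfl <;> simp [hb, cT,
                    c01, c02, c12, c0, c1, c2]
          · -- 0 ∉ U'
            by_cases c1 : ![false, true, false] ∈ U'
            · -- 1 ∈ U'
              by_cases c2 : ![false, false, true] ∈ U'
              · -- 2 ∈ U'
                refine Or.inr (Or.inr (Or.inr (Or.inr (Or.inr (Or.inr (Or.inr (Or.inr (Or.inr (Or.inr (Or.inr (Or.inr
                    (Or.inr (Or.inr (Or.inr (Or.inr (Or.inr (Or.inl ?_)))))))))))))))))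
                ext x
                rcases SahiE3MajPattern.pts x with rfl | rfl | rfl | rfl | rfl | rfl | rfl | rfl <;> simp [hb, cT,
                    c01, c02, c12, c0, c1, c2]
              · -- 2 ∉ U'
                refine Or.inr (Or.inr (Or.inr (Or.inr (Or.inr (Or.inr (Or.inr (Or.inr (Or.inr (Or.inr (Or.inr (Or.inr
                    (Or.inr (Or.inl ?_)))))))))))))
                ext x
                rcases SahiE3MajPattern.pts x with rfl | rfl | rfl | rfl | rfl | rfl | rfl | rfl <;> simp [hb, cT,
                    c01, c02, c12, c0, c1, c2]
            · -- 1 ∉ U'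
              by_cases c2 : ![false, false, true] ∈ U'
              · -- 2 ∈ U'
                refine Or.inr (Or.inr (Or.inr (Or.inr (Or.inr (Or.inr (Or.inr (Or.inr (Or.inr (Or.inr (Or.inr (Or.inr
                    (Or.inr (Or.inr (Or.inl ?_))))))))))))))
                ext x
                rcases SahiE3MajPattern.pts x with rfl | rfl | rfl | rfl | rfl | rfl | rfl | rfl <;> simp [hb, cT,
                    c01, c02, c12, c0, c1, c2]
              · -- 2 ∉ U'
                refine Or.inr (Or.inr (Or.inr (Or.inr (Or.inr (Or.inr (Or.inr (Or.inr (Or.inr (Or.inr (Or.inr (Or.inl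
                    ?_)))))))))))
                ext x
                rcases SahiE3MajPattern.pts x with rfl | rfl | rfl | rfl | rfl | rfl | rfl | rfl <;> simp [hb, cT,
                    c01, c02, c12, c0, c1, c2]
        · -- 12 ∉ U'
          by_cases c0 : ![true, false, false] ∈ U'
          · -- 0 ∈ U'
            have c1 : ![false, true, false] ∉ U' := fun h => c12 (up l_1_12 h)
            have c2 : ![false, false, true] ∉ U' := fun h => c12 (up l_2_12 h)
            refine Or.inr (Or.inr (Or.inr (Or.inr (Or.inr (Or.inr (Or.inr (Or.inr (Or.inl ?_))))))))
            ext x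
            rcases SahiE3MajPattern.pts x with rfl | rfl | rfl | rfl | rfl | rfl | rfl | rfl <;> simp [hb, cT, c01,
                c02, c12, c0, c1, c2]
          · -- 0 ∉ U'
            have c1 : ![false, true, false] ∉ U' := fun h => c12 (up l_1_12 h)
            have c2 : ![false, false, true] ∉ U' := fun h => c12 (up l_2_12 h)
            refine Or.inr (Or.inr (Or.inr (Or.inr (Or.inr (Or.inl ?_)))))
            ext x
            rcases SahiE3MajPattern.pts x with rfl | rfl | rfl | rfl | rfl | rfl | rfl | rfl <;> simp [hb, cT, c01,
                c02, c12, c0, c1, c2]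
      · -- 02 ∉ U'
        by_cases c12 : ![false, true, true] ∈ U'
        · -- 12 ∈ U'
          have c0 : ![true, false, false] ∉ U' := fun h => c02 (up l_0_02 h)
          by_cases c1 : ![false, true, false] ∈ U'
          · -- 1 ∈ U'
            have c2 : ![false, false, true] ∉ U' := fun h => c02 (up l_2_02 h)
            refine Or.inr (Or.inr (Or.inr (Or.inr (Or.inr (Or.inr (Or.inr (Or.inr (Or.inr (Or.inl ?_)))))))))
            ext x
            rcases SahiE3MajPattern.pts x with rfl | rfl | rfl | rfl | rfl | rfl | rfl | rfl <;> simp [hb, cT, c01,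
                c02, c12, c0, c1, c2]
          · -- 1 ∉ U'
            have c2 : ![false, false, true] ∉ U' := fun h => c02 (up l_2_02 h)
            refine Or.inr (Or.inr (Or.inr (Or.inr (Or.inr (Or.inr (Or.inl ?_))))))
            ext x
            rcases SahiE3MajPattern.pts x with rfl | rfl | rfl | rfl | rfl | rfl | rfl | rfl <;> simp [hb, cT, c01,
                c02, c12, c0, c1, c2]
        · -- 12 ∉ U'
          have c0 : ![true, false, false] ∉ U' := fun h => c02 (up l_0_02 h)
          have c1 : ![false, true, false] ∉ U' := fun h => c12 (up l_1_12 h)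
          have c2 : ![false, false, true] ∉ U' := fun h => c02 (up l_2_02 h)
          refine Or.inr (Or.inr (Or.inl ?_))
          ext x
          rcases SahiE3MajPattern.pts x with rfl | rfl | rfl | rfl | rfl | rfl | rfl | rfl <;> simp [hb, cT, c01,
              c02, c12, c0, c1, c2]
    · -- 01 ∉ U'
      by_cases c02 : ![true, false, true] ∈ U'
      · -- 02 ∈ U'
        by_cases c12 : ![false, true, true] ∈ U'
        · -- 12 ∈ U'
          have c0 : ![true, false, false] ∉ U' := fun h => c01 (up l_0_01 h)
          have c1 : ![false, true, false] ∉ U' := fun h => c01 (up l_1_01 h)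
          by_cases c2 : ![false, false, true] ∈ U'
          · -- 2 ∈ U'
            refine Or.inr (Or.inr (Or.inr (Or.inr (Or.inr (Or.inr (Or.inr (Or.inr (Or.inr (Or.inr (Or.inl ?_))))))))))
            ext x
            rcases SahiE3MajPattern.pts x with rfl | rfl | rfl | rfl | rfl | rfl | rfl | rfl <;> simp [hb, cT, c01,
                c02, c12, c0, c1, c2]
          · -- 2 ∉ U'
            refine Or.inr (Or.inr (Or.inr (Or.inr (Or.inr (Or.inr (Or.inr (Or.inl ?_)))))))
            ext x
            rcases SahiE3MajPattern.pts x with rfl | rfl | rfl | rfl | rfl | rfl | rfl | rfl <;> simp [hb, cT, c01,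
                c02, c12, c0, c1, c2]
        · -- 12 ∉ U'
          have c0 : ![true, false, false] ∉ U' := fun h => c01 (up l_0_01 h)
          have c1 : ![false, true, false] ∉ U' := fun h => c01 (up l_1_01 h)
          have c2 : ![false, false, true] ∉ U' := fun h => c12 (up l_2_12 h)
          refine Or.inr (Or.inr (Or.inr (Or.inl ?_)))
          ext x
          rcases SahiE3MajPattern.pts x with rfl | rfl | rfl | rfl | rfl | rfl | rfl | rfl <;> simp [hb, cT, c01,
              c02, c12, c0, c1, c2]
      · -- 02 ∉ U'
        by_cases c12 : ![false, true, true] ∈ U'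
        · -- 12 ∈ U'
          have c0 : ![true, false, false] ∉ U' := fun h => c01 (up l_0_01 h)
          have c1 : ![false, true, false] ∉ U' := fun h => c01 (up l_1_01 h)
          have c2 : ![false, false, true] ∉ U' := fun h => c02 (up l_2_02 h)
          refine Or.inr (Or.inr (Or.inr (Or.inr (Or.inl ?_))))
          ext x
          rcases SahiE3MajPattern.pts x with rfl | rfl | rfl | rfl | rfl | rfl | rfl | rfl <;> simp [hb, cT, c01,
              c02, c12, c0, c1, c2]
        · -- 12 ∉ U'
          have c0 : ![true, false, false] ∉ U' := fun h => c01 (up l_0_01 h)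
          have c1 : ![false, true, false] ∉ U' := fun h => c01 (up l_1_01 h)
          have c2 : ![false, false, true] ∉ U' := fun h => c02 (up l_2_02 h)
          refine Or.inr (Or.inl ?_)
          ext x
          rcases SahiE3MajPattern.pts x with rfl | rfl | rfl | rfl | rfl | rfl | rfl | rfl <;> simp [hb, cT, c01,
              c02, c12, c0, c1, c2]
  · -- T ∉ U'
    have c01 : ![true, true, false] ∉ U' := fun h => cT (up l_01_T h)
    have c02 : ![true, false, true] ∉ U' := fun h => cT (up l_02_T h)
    have c12 : ![false, true, true] ∉ U' := fun h => cT (up l_12_T h)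
    have c0 : ![true, false, false] ∉ U' := fun h => cT (up l_0_T h)
    have c1 : ![false, true, false] ∉ U' := fun h => cT (up l_1_T h)
    have c2 : ![false, false, true] ∉ U' := fun h => cT (up l_2_T h)
    refine Or.inl ?_
    ext x
    rcases SahiE3MajPattern.pts x with rfl | rfl | rfl | rfl | rfl | rfl | rfl | rfl <;> simp [hb, cT, c01, c02, c12,
        c0, c1, c2]

end Summit.CriticalPhenomena.PercolationContinuityZ3.Theorems.SahiE3ThreePrimes
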